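import Literature.NumberTheory.DiophantineGeometry.GenEllLemma35Proofs
import Literature.NumberTheory.DiophantineGeometry.GenEllLemma37Core
import Literature.NumberTheory.DiophantineGeometry.GenEllMellExceptional
import HarnessLib

/-!
# [GenEll] Lemma 3.7 (b) / [IUTchIV] Cor 2.2 (P4): a uniform height bound for semistable curves with
# bounded `j`-conjugates admitting an `l`-cyclic subgroup scheme

S. Mochizuki, *Arithmetic elliptic curves in general position*, Math. J. Okayama Univ. **52** (2010)
[cite: MochizukiGenEll2010], proof of Lemma 3.7, last paragraph (p. 19), and *Inter-universal
Teichmüller theory IV*, proof of Cor. 2.2 (ii), step (P4), p. 45 [cite: Mochizuki2012, IUTchIV Cor 2.2 p.45]: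

> […] the existence of an `l`-cyclic subgroup scheme of `E_F` would imply that
> `((l−2)/24)·log(q^∀) ≤ 2·log(l) + T_K` — where we apply […] the displayed inequality of [GenEll],
> Lemma 3.5, and the final inequality of the display of [GenEll], Proposition 3.4 […]; we write `T_K`
> for the positive real number [which depends only on the choice of the compactly bounded subset
> `K_V`] […] hence that […] `log(q^∀)` is bounded.

PROVED here, UNCONDITIONALLY and pointwise in the bound `R` on the complex conjugates of `j` (the only
way `K_V` enters): there is `B = B(R)` such that every semistable presented elliptic curve `E_F` with
`|σ(j_E)| ≤ R` for all `σ : F → ℂ`, admitting an `l`-cyclic subgroup scheme for a prime `l` prime to its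
local heights at the primes of multiplicative reduction, has `ht_∞([E]) ≤ B` — hence (Prop. 3.4)
`deg_∞([E]) ≤ B` and bounded `ht_Falt`, and, in each degree, finitely many `j`-invariants
(`mellExcGaloisFinite_htInfLe`).  Inputs, all tree theorems: [GenEll] Lemma 3.5 over arbitrary number
fields (`GenEll_lemma35_general`, abc-iut-S-d1), Prop. 3.4 (`prop34Ineq_of_pos`, abc-iut-S-d3), the
archimedean bound `EllPoint.htInf_le_degInf_add_of_norm_le` and the real-number core `Lemma37.htInf_le`
(abc-iut-S-d4; valid for every prime `l ≥ 2`).  Proof-only; no definitions.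
-/

noncomputable section

namespace Literature.NumberTheory.DiophantineGeometry.GenEll

open _root_.NumberField _root_.IsDedekindDomain
open scoped NumberField

/-- **Uniform bound on `ht_∞` for semistable curves with bounded `j`-conjugates and an `l`-cyclic
subgroup scheme** ([GenEll] Lemma 3.7 (b), last conclusion; [IUTchIV] Cor. 2.2 (P4)): for every
`R` there is `B` such that for every presented semistable `E_F` with `|σ j_E| ≤ R` (`σ : F → ℂ`) and
every prime `l` prime to the local heights at the primes of multiplicative reduction, if `E_F` admits an
`l`-cyclic subgroup scheme then `ht_∞([E_F]) ≤ B`.  (`B` does not depend on `E`, `F`, `[F:ℚ]` or `l`.)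
[cite: MochizukiGenEll2010, Lem 3.7 p.19] -/
theorem exists_htInf_le_of_admitsLCyclic (R : ℝ) :
    ∃ B : ℝ, ∀ (P : EllPoint) (l : ℕ), l.Prime → P.IsSemistable →
      (∀ σ : P.F →+* ℂ, ‖σ P.W.j‖ ≤ R) →
      (∀ v : HeightOneSpectrum (𝓞 P.F), P.W.HasMultiplicativeReductionAt v →
        ¬ ((l : ℤ) ∣ P.localHeight v)) →
      P.AdmitsLCyclic l → P.htInf ≤ B := by
  -- Prop. 3.4, last `≲`, at `ε = 1/6`; Lemma 3.5 at `ε = 1/6` (`12(1+ε) = 14`)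
  obtain ⟨-, -, ⟨K₂', hK₂'⟩⟩ := prop34Ineq_of_pos (by norm_num : (0 : ℝ) < 1 / 6)
  obtain ⟨C', hC'⟩ := GenEll_lemma35_general (1 / 6) (by norm_num)
  set K₂ : ℝ := max K₂' 0 with hK₂
  set A : ℝ := Real.log (max R 1) with hA
  refine ⟨168 / 5 * (max 0 (A / 12 + K₂ / 12 + C') / 2 + 2) + A,
    fun P l hl hss hR hcop hcyc => ?_⟩
  have hK₂0 : 0 ≤ K₂ := le_max_right _ _
  have hl2 : (2 : ℝ) ≤ l := by exact_mod_cast hl.two_le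
  have hD0 : 0 ≤ P.degInf := P.degInf_nonneg
  have hHA : P.htInf ≤ P.degInf + A := P.htInf_le_degInf_add_of_norm_le hR
  have h34 : 12 * (1 + 1 / 6) * P.htFalt ≤ (1 + 1 / 6) * P.htInf + K₂ := by
    have h := hK₂' P (Set.mem_univ _)
    have hK1 : K₂' ≤ K₂ := le_max_left _ _
    linarith
  have hdag : (l : ℝ) / 14 * P.degInf ≤ P.htFalt + 2 * Real.log l + C' := by
    have h := hC' P l hl hss hcyc hcop
    have e : (12 * (1 + 1 / 6 : ℝ))⁻¹ * l * P.degInf = (l : ℝ) / 14 * P.degInf := by ring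
    linarith
  exact Lemma37.htInf_le (by norm_num : (0 : ℝ) ≤ 1 / 6) hK₂0 hl2 hD0 hHA h34 hdag

/-- The same bound controls `deg_∞` (`deg_∞ ≤ ht_∞`, Prop. 3.4 first `≲` with constant `0`) — the
quantity `log(q^∀)` of [IUTchIV] Cor. 2.2 (P4). [cite: Mochizuki2012, IUTchIV Cor 2.2 p.45] -/
theorem exists_degInf_le_of_admitsLCyclic (R : ℝ) :
    ∃ B : ℝ, ∀ (P : EllPoint) (l : ℕ), l.Prime → P.IsSemistable →
      (∀ σ : P.F →+* ℂ, ‖σ P.W.j‖ ≤ R) →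
      (∀ v : HeightOneSpectrum (𝓞 P.F), P.W.HasMultiplicativeReductionAt v →
        ¬ ((l : ℤ) ∣ P.localHeight v)) →
      P.AdmitsLCyclic l → P.degInf ≤ B := by
  obtain ⟨B, hB⟩ := exists_htInf_le_of_admitsLCyclic R
  exact ⟨B, fun P l hl hss hR hcop hcyc => P.degInf_le_htInf.trans (hB P l hl hss hR hcop hcyc)⟩

/-- **Finiteness form** ([GenEll] Lemma 3.7: "`[E_L]` belongs to some [fixed] finite exceptional set
`Exc_d`"; [IUTchIV] Cor. 2.2 (P4): "there is only a finite number of possibilities for the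
`j`-invariant of `E_F`"): for every `R` there is a Galois-finite set `Exc` of minimal polynomials
(finitely many in each degree) containing `minpoly_ℚ(j_E)` for every such `E_F`.
[cite: MochizukiGenEll2010, Lem 3.7 p.19] -/
theorem exists_mellExcGaloisFinite_of_admitsLCyclic (R : ℝ) :
    ∃ Exc : Set (Polynomial ℚ), MellExcGaloisFinite Exc ∧
      ∀ (P : EllPoint) (l : ℕ), l.Prime → P.IsSemistable →
        (∀ σ : P.F →+* ℂ, ‖σ P.W.j‖ ≤ R) →
        (∀ v : HeightOneSpectrum (𝓞 P.F), P.W.HasMultiplicativeReductionAt v →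
          ¬ ((l : ℤ) ∣ P.localHeight v)) →
        P.AdmitsLCyclic l → MellExcMem Exc P := by
  obtain ⟨B, hB⟩ := exists_htInf_le_of_admitsLCyclic R
  exact ⟨{f | ∃ Q : EllPoint, minpoly ℚ Q.W.j = f ∧ Q.htInf ≤ B}, mellExcGaloisFinite_htInfLe B,
    fun P l hl hss hR hcop hcyc => mellExcMem_htInfLe P (hB P l hl hss hR hcop hcyc)⟩

end Literature.NumberTheory.DiophantineGeometry.GenEll

end
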